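import Literature.NumberTheory.LFunctions.SchoenfeldZeroSums
import Mathlib
import HarnessLib

/-!
# HANDOFF — DEFINITIONS for the dodger witness: the node `z_ρ = −i(ρ − ½)` and the dodger polynomial `P_T(u) = Π_{ρ ∈ zerosBetween 0 T}(1 − u/z_ρ²)^{m(ρ)}` of a killing height (rh-explicit, track «HANDOFF», seat prove-2 gen9, ATTEMPT-18 §3 (R-1))

HONEST FRAMING. Nothing here bears on the truth of RH. ATTEMPT-16's dodger kills zeros of `ζ` with a polynomial `S(ξ) = Π(1 − ξ²/z_k²)`; in the
kernel form of ATTEMPT-18 (D-2)/(D-3) the killed multiset is `zerosBetween 0 T` (all zeros with `0 < Im ρ ≤ T`, with multiplicity) and the polynomial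
lives in `ℂ[X]`. THIS FILE defines the two objects and proves their elementary API:

* `dodgerNode ρ = Im ρ + i(½ − Re ρ)` with `½ + i·dodgerNode ρ = ρ` (`half_add_I_mul_dodgerNode`), `dodgerNode (1 − ρ̄) = conj (dodgerNode ρ)`,
  `|Im (dodgerNode ρ)| ≤ ½` on the closed strip, `dodgerNode ρ ≠ 0` off the real axis;
* `dodgerPoly T = Π_{ρ ∈ zerosBetween 0 T} (1 − X/(dodgerNode ρ)²)^{m(ρ)}` (`m = riemannZetaZeroOrder`, as a natural number): `eval_dodgerPoly`,
  `dodgerPoly_eval_zero = 1`, `natDegree_dodgerPoly_le : deg ≤ N(T)` (`Σ_{zerosBetween 0 T} m = N(T)`), `dodgerPoly_eval_node_sq = 0` at every killed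
  zero, and — the point of (D-3)(i) — **`conj_eval_dodgerPoly` / `im_eval_dodgerPoly_ofReal`: `P_T(u) ∈ ℝ` for real `u`**, by the involution `ρ ↦ 1 − ρ̄`
  of `zerosBetween 0 T` (tree: `ZetaZeros.riemannZetaNontrivialZeros.one_sub_conj_mem`, `riemannZetaZeroOrder_one_sub_conj`), so that the cut-off cosine
  polynomial built from `P_T` (`HandoffDodgerTransformComplex`) has REAL coefficients and the witness `θ` is real.
No `sorry`, standard axioms.

References: this track (ATTEMPT-16 §1–§2; ATTEMPT-18 §1 (D-2), (D-3), §3 (R-1)). E. C. Titchmarsh, The Theory of the Riemann Zeta-Function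
(1986), §2.12 (the symmetries `ρ ↦ ρ̄`, `ρ ↦ 1 − ρ` of the zeros and their multiplicities).
-/

set_option linter.dupNamespace false

noncomputable section

open Complex Polynomial Finset
open scoped ComplexConjugate

namespace Summit.RiemannHypothesis.RiemannHypothesis.Theorems.Handoff

open Literature.NumberTheory.LFunctions Literature.NumberTheory.LFunctions.SchoenfeldBound

/-! ## The node -/

/-- The node of a zero: `z_ρ := Im ρ + i(½ − Re ρ) = −i(ρ − ½)`, so that `ρ = ½ + i z_ρ`. [this track, ATTEMPT-16 §1] -/
def dodgerNode (ρ : ℂ) : ℂ := ((ρ.im : ℝ) : ℂ) + ((1 / 2 - ρ.re : ℝ) : ℂ) * I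

/-- `Re z_ρ = Im ρ`. [folklore] -/
@[simp] theorem dodgerNode_re (ρ : ℂ) : (dodgerNode ρ).re = ρ.im := by simp [dodgerNode]

/-- `Im z_ρ = ½ − Re ρ`. [folklore] -/
@[simp] theorem dodgerNode_im (ρ : ℂ) : (dodgerNode ρ).im = 1 / 2 - ρ.re := by simp [dodgerNode]

/-- `½ + i·z_ρ = ρ`. [this track, ATTEMPT-16 §1] -/
theorem half_add_I_mul_dodgerNode (ρ : ℂ) : 1 / 2 + I * dodgerNode ρ = ρ := by
  apply Complex.ext <;> simp [dodgerNode]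

/-- The reflection `ρ ↦ 1 − ρ̄` conjugates the node. [this track, ATTEMPT-18 (D-3)] -/
theorem dodgerNode_one_sub_conj (ρ : ℂ) : dodgerNode (1 - conj ρ) = conj (dodgerNode ρ) := by
  apply Complex.ext <;> simp [dodgerNode]; ring

/-- On the closed critical strip the node lies in the horizontal strip `|Im z| ≤ ½`. [folklore] -/
theorem abs_im_dodgerNode_le {ρ : ℂ} (h0 : 0 ≤ ρ.re) (h1 : ρ.re ≤ 1) : |(dodgerNode ρ).im| ≤ 1 / 2 := by
  rw [dodgerNode_im, abs_le]; constructor <;> linarith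

/-- Off the real axis the node is non-zero. [folklore] -/
theorem dodgerNode_ne_zero {ρ : ℂ} (h : ρ.im ≠ 0) : dodgerNode ρ ≠ 0 := by
  intro h0
  have := congrArg Complex.re h0
  rw [dodgerNode_re, Complex.zero_re] at this
  exact h this

/-! ## The dodger polynomial of a killing height -/

/-- **The dodger polynomial** `P_T(u) := Π_{ρ ∈ zerosBetween 0 T} (1 − u/z_ρ²)^{m(ρ)}` (multiplicity as a natural number).
[this track, ATTEMPT-18 (D-2)] -/
def dodgerPoly (T : ℝ) : ℂ[X] :=
  ∏ ρ ∈ zerosBetween 0 T, (1 - C ((dodgerNode ρ ^ 2)⁻¹) * X) ^ (riemannZetaZeroOrder ρ).toNat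

/-- Evaluation: `P_T(u) = Π_ρ (1 − u/z_ρ²)^{m(ρ)}`. [this track, ATTEMPT-18 (D-2)] -/
theorem eval_dodgerPoly (T : ℝ) (u : ℂ) :
    (dodgerPoly T).eval u = ∏ ρ ∈ zerosBetween 0 T, (1 - u / dodgerNode ρ ^ 2) ^ (riemannZetaZeroOrder ρ).toNat := by
  simp only [dodgerPoly, eval_prod, eval_pow, eval_sub, eval_one, eval_mul, eval_C, eval_X]
  refine Finset.prod_congr rfl fun ρ _ => ?_
  congr 1
  rw [div_eq_mul_inv, mul_comm]

/-- `P_T(0) = 1`. [this track, ATTEMPT-18 (D-2)] -/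
theorem dodgerPoly_eval_zero (T : ℝ) : (dodgerPoly T).eval 0 = 1 := by
  rw [eval_dodgerPoly]; simp

/-- The multiplicities over `zerosBetween 0 T` sum to `N(T)` (as natural numbers). [folklore] -/
theorem sum_zeroOrder_toNat_eq (T : ℝ) :
    ∑ ρ ∈ zerosBetween 0 T, (riemannZetaZeroOrder ρ).toNat = zetaZeroCount T := by
  rcases le_or_gt 0 T with hT | hT
  · have h := zetaZeroCount_sub_eq_sum hT
    rw [zetaZeroCount_eq_zero_of_nonpos le_rfl, Nat.cast_zero, sub_zero] at h
    have e : ∀ ρ ∈ zerosBetween 0 T, ((riemannZetaZeroOrder ρ).toNat : ℝ) = (riemannZetaZeroOrder ρ : ℝ) := by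
      intro ρ hρ
      have h0 : 0 ≤ riemannZetaZeroOrder ρ := by exact_mod_cast zeroOrder_nonneg_of_mem_zerosBetween le_rfl hρ
      have : ((riemannZetaZeroOrder ρ).toNat : ℤ) = riemannZetaZeroOrder ρ := Int.toNat_of_nonneg h0
      exact_mod_cast this
    have h2 : ((∑ ρ ∈ zerosBetween 0 T, (riemannZetaZeroOrder ρ).toNat : ℕ) : ℝ) = (zetaZeroCount T : ℝ) := by
      push_cast; rw [h]; exact Finset.sum_congr rfl e
    exact_mod_cast h2
  · have hempty : zerosBetween 0 T = ∅ := by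
      ext ρ
      simp only [mem_zerosBetween le_rfl, Finset.notMem_empty, iff_false, not_and, not_le]
      intro _ _ _ h3; linarith
    rw [hempty, Finset.sum_empty, zetaZeroCount_eq_zero_of_nonpos hT.le]

/-- `deg P_T ≤ N(T)`. [this track, ATTEMPT-18 (D-2)] -/
theorem natDegree_dodgerPoly_le (T : ℝ) : (dodgerPoly T).natDegree ≤ zetaZeroCount T := by
  rw [dodgerPoly, ← sum_zeroOrder_toNat_eq T]
  refine (natDegree_prod_le _ _).trans (Finset.sum_le_sum fun ρ _ => ?_)
  refine (natDegree_pow_le).trans ?_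
  have h : (1 - C ((dodgerNode ρ ^ 2)⁻¹) * X : ℂ[X]).natDegree ≤ 1 := by
    refine (natDegree_sub_le _ _).trans ?_
    rw [natDegree_one, Nat.zero_max]
    exact (natDegree_C_mul_le _ _).trans natDegree_X_le
  calc (riemannZetaZeroOrder ρ).toNat * (1 - C ((dodgerNode ρ ^ 2)⁻¹) * X : ℂ[X]).natDegree
      ≤ (riemannZetaZeroOrder ρ).toNat * 1 := Nat.mul_le_mul_left _ h
    _ = (riemannZetaZeroOrder ρ).toNat := mul_one _

/-- Every killed zero is a root: `P_T(z_ρ²) = 0` for `ρ ∈ zerosBetween 0 T`. [this track, ATTEMPT-18 (D-2)] -/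
theorem dodgerPoly_eval_node_sq {T : ℝ} {ρ : ℂ} (hρ : ρ ∈ zerosBetween 0 T) :
    (dodgerPoly T).eval (dodgerNode ρ ^ 2) = 0 := by
  rw [eval_dodgerPoly]
  refine Finset.prod_eq_zero hρ ?_
  obtain ⟨hz, -, -, h3, -⟩ := (mem_zerosBetween le_rfl).1 hρ
  have hn : dodgerNode ρ ^ 2 ≠ 0 := pow_ne_zero 2 (dodgerNode_ne_zero h3.ne')
  have hm : 1 ≤ (riemannZetaZeroOrder ρ).toNat := by
    have h1 := ZetaZeros.riemannZetaNontrivialZeros.one_le_order (ZetaZeros.riemannZetaNontrivialZeros.mem_of_im_ne_zero hz h3.ne')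
    omega
  rw [div_self hn, sub_self, zero_pow (by omega)]

/-! ## Real-valuedness on the real axis: the involution `ρ ↦ 1 − ρ̄` -/

/-- `ρ ↦ 1 − ρ̄` maps `zerosBetween 0 T` to itself. [cite: Titchmarsh1986, §2.12] -/
theorem one_sub_conj_mem_zerosBetween {T : ℝ} {ρ : ℂ} (hρ : ρ ∈ zerosBetween 0 T) : 1 - conj ρ ∈ zerosBetween 0 T := by
  obtain ⟨hz, h1, h2, h3, h4⟩ := (mem_zerosBetween le_rfl).1 hρ
  have hmem := ZetaZeros.riemannZetaNontrivialZeros.mem_of_im_ne_zero hz h3.ne'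
  have hmem' := ZetaZeros.riemannZetaNontrivialZeros.one_sub_conj_mem hmem
  refine (mem_zerosBetween le_rfl).2 ⟨ZetaZeros.riemannZetaNontrivialZeros.zeta_eq_zero hmem', ?_, ?_, ?_, ?_⟩
  · simp only [sub_re, one_re, conj_re]; linarith
  · simp only [sub_re, one_re, conj_re]; linarith
  · simp only [sub_im, one_im, conj_im]; linarith
  · simp only [sub_im, one_im, conj_im]; linarith

/-- The multiplicity is invariant under `ρ ↦ 1 − ρ̄` on `zerosBetween 0 T`. [cite: Titchmarsh1986, §2.12] -/
theorem zeroOrder_one_sub_conj {T : ℝ} {ρ : ℂ} (hρ : ρ ∈ zerosBetween 0 T) :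
    riemannZetaZeroOrder (1 - conj ρ) = riemannZetaZeroOrder ρ := by
  obtain ⟨hz, -, -, h3, -⟩ := (mem_zerosBetween le_rfl).1 hρ
  have hmem := ZetaZeros.riemannZetaNontrivialZeros.mem_of_im_ne_zero hz h3.ne'
  exact riemannZetaZeroOrder_one_sub_conj (ZetaZeros.riemannZetaNontrivialZeros.re_pos hmem)
    (ZetaZeros.riemannZetaNontrivialZeros.re_lt_one hmem)

/-- **`P_T(u)` is real for real `u`**: `conj (P_T(u)) = P_T(u)`. [this track, ATTEMPT-18 (D-3)] -/
theorem conj_eval_dodgerPoly (T u : ℝ) : conj ((dodgerPoly T).eval (u : ℂ)) = (dodgerPoly T).eval (u : ℂ) := by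
  rw [eval_dodgerPoly, map_prod]
  -- conj of each factor is the factor at the reflected zero
  have hterm : ∀ ρ ∈ zerosBetween 0 T,
      conj ((1 - (u : ℂ) / dodgerNode ρ ^ 2) ^ (riemannZetaZeroOrder ρ).toNat) =
        (1 - (u : ℂ) / dodgerNode (1 - conj ρ) ^ 2) ^ (riemannZetaZeroOrder (1 - conj ρ)).toNat := by
    intro ρ hρ
    rw [zeroOrder_one_sub_conj hρ, dodgerNode_one_sub_conj, map_pow, map_sub, map_one, map_div₀, Complex.conj_ofReal, map_pow]
  rw [Finset.prod_congr rfl hterm]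
  -- reindex by the involution
  refine Finset.prod_bij' (fun ρ _ => 1 - conj ρ) (fun ρ _ => 1 - conj ρ) (fun ρ hρ => one_sub_conj_mem_zerosBetween hρ)
    (fun ρ hρ => one_sub_conj_mem_zerosBetween hρ) (fun ρ _ => by simp) (fun ρ _ => by simp) (fun ρ _ => rfl)

/-- `Im P_T(u) = 0` for real `u`. [this track, ATTEMPT-18 (D-3)] -/
theorem im_eval_dodgerPoly_ofReal (T u : ℝ) : ((dodgerPoly T).eval (u : ℂ)).im = 0 :=
  Complex.conj_eq_iff_im.1 (conj_eval_dodgerPoly T u)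

end Summit.RiemannHypothesis.RiemannHypothesis.Theorems.Handoff

end
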